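import Summits.CriticalPhenomena.CardyFormulaZ2.Theorems.CardySusyWardParafermionFamiliesToSLESixDefs
import Literature.Probability.LatticeModels.MeshDomainBulk
import Literature.Probability.LatticeModels.MedialExplorationChains
import Literature.Probability.LatticeModels.DartPhase

/-!
# Bulk dichotomy for the line `Sketch` of the crux `CardySusyWard.WeakHolomorphy`

Stub `stub_bulkDichotomy` of the skeleton (stmt-CriticalPhenomena-11292), pure lattice topology:
along an admissible discretisation family `Λ` of a Dobrushin (Jordan) domain `D`
(`(Λ δ).Ω = D.carrier`, `(Λ δ).δ = δ`), for every compact `K ⊂ Ω` and all small mesh `δ`, EITHER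
every medial vertex `s(x, x + eᵢ)` with midpoint in `K` is an interior medial vertex of `Λ δ`
(`IsInteriorMV`: an edge of `Ω_δ`, endpoints off the discrete arcs, both adjacent faces inner), OR
the medial exploration path of `Λ δ` traverses none of the four corners at such a medial vertex
(all four dart phase sums vanish, for every configuration). Proof: the lattice points of the bulk
neighbourhood `V ⊇ K` of `MeshDomainBulk.lean` (steps 1–2 there: `exists_isOpen_isPreconnected_bulk`,
`meshVertexGraph_reachable_of_mem_bulk`) lie in ONE component of the mesh graph, so either all of
them or none of them belong to H21's `meshDomain Ω δ` (the union of the largest components); in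
the first case every lattice edge near `K` is an edge of `Ω_δ` (interiority), in the second no face
near `K` is inner, whereas a traversed corner lies in an inner face (`IsMedialExploration.step`).
No null-boundary proviso is needed.
-/

noncomputable section

namespace Summit.CriticalPhenomena.CardyFormulaZ2.Theorems.WeakHolomorphy.SplitBypass

open scoped BigOperators Topology
open Filter Set MeasureTheory
open _root_.Literature.Probability.LatticeModels
open _root_.Literature.Probability.RandomPlanarGeometry (DobrushinDomain)
open _root_.Literature.Probability.Percolation (BondConfig bondPercolation half)
open _root_.Literature.Barriers.CriticalPhenomena (medialCornersAt medialVertexOf halfCRForm HalfCRRelationAt)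
open _root_.Literature.Barriers.CriticalPhenomena.HalfCRGreen (coeff twin)
open Summit.CriticalPhenomena.CardyFormulaZ2.Theorems.ParafermionPrecompact.Negative (F IsFamily)
open Summit.CriticalPhenomena.CardyFormulaZ2.Theorems.ParafermionFamiliesToSLESix.StripAnchored
  (G IsInteriorMV stagger StaggeredVanishes HalfCRVertexRelation)

/-! ### Lattice distances -/

/-- Adjacent sites of `ℤ²` have mesh points at distance at most `δ` (in fact exactly `δ`;
cf. `dist_meshPoint_of_adj` of `Percolation/BoxCrossingProofs.lean`, not in the import cone). [folklore] -/
private theorem dist_meshPoint_le_of_adj {δ : ℝ} (hδ : 0 ≤ δ) {x y : Site 2}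
    (h : (zdGraph 2).Adj x y) : dist (meshPoint δ x) (meshPoint δ y) ≤ δ := by
  -- adapted from `Literature.Probability.Percolation.dist_meshPoint_of_adj`
  have key : ∀ (u : Site 2) (i : Fin 2),
      dist (meshPoint δ u) (meshPoint δ (u + Pi.single i 1)) ≤ δ := by
    intro u i
    rw [Complex.dist_eq]
    refine (Complex.norm_le_abs_re_add_abs_im _).trans ?_
    have hre : (meshPoint δ u - meshPoint δ (u + Pi.single i 1)).re =
        -(δ * (Pi.single (M := fun _ : Fin 2 => ℤ) i (1 : ℤ) 0 : ℤ)) := by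
      simp only [Complex.sub_re, meshPoint_re, Pi.add_apply, Int.cast_add]; ring
    have him : (meshPoint δ u - meshPoint δ (u + Pi.single i 1)).im =
        -(δ * (Pi.single (M := fun _ : Fin 2 => ℤ) i (1 : ℤ) 1 : ℤ)) := by
      simp only [Complex.sub_im, meshPoint_im, Pi.add_apply, Int.cast_add]; ring
    rw [hre, him]
    fin_cases i <;> simp [abs_of_nonneg hδ]
  obtain ⟨i, rfl | rfl⟩ := (zdGraph_adj_iff x y).1 h
  · exact key x i
  · rw [dist_comm]; exact key y i

/-- Both endpoints of the lattice edge `s(x, x + eᵢ)` have mesh points within `δ` (in fact `δ/2`)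
of its midpoint. [folklore] -/
private theorem dist_meshPoint_medialPoint_le {δ : ℝ} (hδ : 0 ≤ δ) (p : Site 2 × Fin 2)
    {y : Site 2} (hy : y ∈ medialVertexOf p) :
    dist (meshPoint δ y) (medialPoint δ (medialVertexOf p)) ≤ δ := by
  obtain ⟨x, i⟩ := p
  have hadj : (zdGraph 2).Adj x (x + Pi.single i 1) := (zdGraph_adj_iff _ _).2 ⟨i, Or.inl rfl⟩
  have hd := dist_meshPoint_le_of_adj hδ hadj
  have key : ∀ a b : ℂ, dist a ((a + b) / 2) ≤ dist a b := fun a b => by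
    rw [Complex.dist_eq, Complex.dist_eq, show a - (a + b) / 2 = (a - b) / 2 by ring, norm_div,
      Complex.norm_two]
    linarith [norm_nonneg (a - b)]
  simp only [medialVertexOf] at hy ⊢
  rw [medialPoint_mk]
  rcases Sym2.mem_iff.1 hy with rfl | rfl
  · exact (key _ _).trans hd
  · rw [add_comm (meshPoint δ x)]
    rw [dist_comm] at hd
    exact (key _ _).trans hd

/-! ### Interiority near a point all of whose nearby lattice edges are edges of `Ω_δ` -/

/-- If every lattice edge at a site within `5δ` of `m` is an edge of `Ω_δ`, then every face with a
corner within `δ` of `m` is an inner face. [folklore] -/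
private theorem isInnerFace_of_near {E : DiscreteDobrushin} {m : ℂ}
    (hdeep : ∀ x y : Site 2, dist (meshPoint E.δ x) m ≤ 5 * E.δ →
      (zdGraph 2).Adj x y → (discreteDomainGraph E.Ω E.δ).Adj x y)
    (hδ : 0 ≤ E.δ) {y g : Site 2} (hyg : IsCorner y g) (hy : dist (meshPoint E.δ y) m ≤ E.δ) :
    E.IsInnerFace g := fun v w hv _ hadj =>
  -- adapted from `isInnerFace_of_deep` (Theorems/CardyComplexConeEdgePrecompactPassageAgree.lean)
  hdeep v w (by
    have h1 := dist_meshPoint_le_of_isCorner hδ hv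
    have h2 := dist_meshPoint_le_of_isCorner hδ hyg
    have h3 := dist_triangle4 (meshPoint E.δ v) (meshPoint E.δ g) (meshPoint E.δ y) m
    rw [dist_comm] at h2
    linarith) hadj

/-- If every lattice edge at a site within `5δ` of `m` is an edge of `Ω_δ`, then no site within
`δ` of `m` lies on the square-lattice discrete boundary `zdBoundary`. [folklore] -/
private theorem not_mem_zdBoundary_of_near {E : DiscreteDobrushin} {m : ℂ}
    (hdeep : ∀ x y : Site 2, dist (meshPoint E.δ x) m ≤ 5 * E.δ →
      (zdGraph 2).Adj x y → (discreteDomainGraph E.Ω E.δ).Adj x y)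
    (hδ : 0 ≤ E.δ) {y : Site 2} (hy : dist (meshPoint E.δ y) m ≤ E.δ) : y ∉ E.zdBoundary := by
  -- adapted from `not_mem_zdBoundary_of_deep` (Theorems/CardyComplexConeEdgePrecompactPassageAgree.lean)
  rintro (⟨-, y', hadj, hn⟩ | ⟨y', -, -, g, hg, hyg, -⟩)
  · exact hn (hdeep y y' (by linarith) hadj)
  · exact hg (isInnerFace_of_near hdeep hδ hyg hy)

/-- If every lattice edge at a site within `5δ` of the midpoint of `s(x, x + eᵢ)` is an edge of
`Ω_δ`, then `(x, i)` indexes an interior medial vertex. [folklore] -/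
private theorem isInteriorMV_of_near {E : DiscreteDobrushin} {p : Site 2 × Fin 2}
    (hdeep : ∀ x y : Site 2,
      dist (meshPoint E.δ x) (medialPoint E.δ (medialVertexOf p)) ≤ 5 * E.δ →
        (zdGraph 2).Adj x y → (discreteDomainGraph E.Ω E.δ).Adj x y)
    (hδ : 0 ≤ E.δ) : IsInteriorMV E p := by
  have h1 : dist (meshPoint E.δ p.1) (medialPoint E.δ (medialVertexOf p)) ≤ E.δ :=
    dist_meshPoint_medialPoint_le hδ p (Sym2.mem_mk_left _ _)
  unfold IsInteriorMV
  refine ⟨?_, fun y hy => ?_, fun f hf _ => isInnerFace_of_near hdeep hδ hf h1⟩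
  · show s(p.1, p.1 + Pi.single p.2 1) ∈ (discreteDomainGraph E.Ω E.δ).edgeSet
    rw [SimpleGraph.mem_edgeSet]
    exact hdeep _ _ (by linarith) ((zdGraph_adj_iff _ _).2 ⟨p.2, Or.inl rfl⟩)
  · have hyB := not_mem_zdBoundary_of_near hdeep hδ (dist_meshPoint_medialPoint_le hδ p hy)
    exact ⟨fun h => hyB (E.zdArcA_subset_zdBoundary h), fun h => hyB (E.zdArcB_subset_zdBoundary h)⟩

/-! ### The dichotomy -/

/-- **`stub_bulkDichotomy` — bulk dichotomy (lattice topology).** Along an admissible family of the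
Jordan domain `D`, over a compact `K ⊂ Ω`, eventually in `δ`: either every medial vertex above `K`
is an interior medial vertex of `Λ δ`, or the exploration path never traverses any corner above `K`
(according as the mesh component of the bulk is, or is not, a largest component — H21's
`meshDomain`). [folklore] -/
theorem stub_bulkDichotomy : ∀ (D : DobrushinDomain) (Λ : ℝ → DiscreteDobrushin), IsFamily D Λ →
    ∀ (K : Set ℂ), IsCompact K → K ⊆ D.carrier → ∀ᶠ δ in 𝓝[>] (0:ℝ),
      (∀ p : Site 2 × Fin 2, medialPoint δ (medialVertexOf p) ∈ K → IsInteriorMV (Λ δ) p) ∨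
      (∀ p : Site 2 × Fin 2, medialPoint δ (medialVertexOf p) ∈ K →
        ∀ (k : Fin 4) (ω : BondConfig (Site 2)),
          Parafermion.dartPhaseSum (medialExploration (Λ δ) ω) δ (1 / 3) (medialCornersAt p.1 p.2 k) = 0) := by
  intro D Λ hΛ K hK hKD
  have hne : D.carrierᶜ.Nonempty := nonempty_compl.2 D.carrier_ne_univ
  -- (1) thicken `K` inside `Ω`; (2) the bulk neighbourhood `V` of the thickening
  obtain ⟨r₁, hr₁, hK₁⟩ := hK.exists_cthickening_subset_open D.isOpen hKD
  obtain ⟨V, -, hVc, hKV, -, ρ, hρ, hVρ⟩ :=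
    exists_isOpen_isPreconnected_bulk D.isOpen D.isConnected hne hK.cthickening hK₁
  have hVΩ : ∀ w ∈ V, Metric.ball w ρ ⊆ D.carrier := fun w hw =>
    (Metric.ball_subset_ball (hVρ w hw).le).trans Metric.ball_infDist_compl_subset
  -- (3) small mesh
  have hpos : (0:ℝ) < min (ρ / 3) (r₁ / 6) := by positivity
  filter_upwards [Ioo_mem_nhdsGT hpos] with δ hδ
  obtain ⟨hδ0, hδlt⟩ := hδ
  have hδρ : 3 * δ ≤ ρ := by
    have := hδlt.le.trans (min_le_left _ _); linarith
  have hδr : 6 * δ ≤ r₁ := by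
    have := hδlt.le.trans (min_le_right _ _); linarith
  have hΩeq : (Λ δ).Ω = D.carrier := hΛ.1 δ
  have hδeq : (Λ δ).δ = δ := hΛ.2.1 δ
  -- lattice points within `6δ` of `K` have mesh points in `V`
  have hnear : ∀ m ∈ K, ∀ y : Site 2, dist (meshPoint δ y) m ≤ 6 * δ → meshPoint δ y ∈ V :=
    fun m hm y hy => hKV (Metric.mem_cthickening_of_dist_le _ _ _ _ hm (hy.trans hδr))
  by_cases hA : ∀ y : Site 2, meshPoint δ y ∈ V → y ∈ meshDomain D.carrier δ
  · -- CASE A: the bulk component is a largest one; every lattice edge near `K` is an edge of `Ω_δ`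
    refine Or.inl fun p hp => isInteriorMV_of_near ?_ (by rw [hδeq]; exact hδ0.le)
    rw [hΩeq, hδeq]
    intro x y hx hxy
    have hd := dist_meshPoint_le_of_adj hδ0.le hxy
    have hxV : meshPoint δ x ∈ V := hnear _ hp x (by linarith)
    have hyV : meshPoint δ y ∈ V := hnear _ hp y (by
      have h2 := dist_triangle (meshPoint δ y) (meshPoint δ x) (medialPoint δ (medialVertexOf p))
      rw [dist_comm] at hd
      linarith)
    refine discreteDomainGraph_adj_iff.2 ⟨meshGraph_adj_iff.2 ⟨hxy, ?_⟩, hA x hxV, hA y hyV⟩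
    have hyb : meshPoint δ y ∈ Metric.ball (meshPoint δ x) ρ := by
      rw [Metric.mem_ball, dist_comm]
      linarith
    exact ((convex_ball (meshPoint δ x) ρ).segment_subset (Metric.mem_ball_self hρ) hyb).trans
      ((hVΩ _ hxV).trans subset_closure)
  · -- CASE B: no lattice point of `V` lies in `Ω_δ`; no corner near `K` is ever traversed
    push Not at hA
    obtain ⟨y₀, hy₀V, hy₀D⟩ := hA
    have hB : ∀ y : Site 2, meshPoint δ y ∈ V → y ∉ meshDomain D.carrier δ := by
      intro y hyV hyD
      obtain ⟨hy, hy₀, hr⟩ := meshVertexGraph_reachable_of_mem_bulk hδ0 hδρ hVc hVΩ hyV hy₀V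
      apply hy₀D
      -- adapted from `eventually_mem_meshDomain_of_reachable` (MeshDomainBulk.lean)
      simp only [meshDomain, mem_iUnion, mem_image] at hyD ⊢
      obtain ⟨C, hC, y', hy'C, hy'y⟩ := hyD
      refine ⟨C, hC, ⟨y₀, hy₀⟩, ?_, rfl⟩
      rw [SimpleGraph.ConnectedComponent.mem_supp_iff] at hy'C ⊢
      rw [← hy'C]
      have hyy' : (⟨y, hy⟩ : meshVertices D.carrier δ) = y' := Subtype.ext hy'y.symm
      exact SimpleGraph.ConnectedComponent.sound (hyy' ▸ hr.symm)
    refine Or.inr fun p hp k ω => ?_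
    obtain ⟨x, i⟩ := p
    have hck := _root_.Literature.Barriers.CriticalPhenomena.isCorner_medialCornersAt x i k
    have hce := _root_.Literature.Barriers.CriticalPhenomena.cornerEdge_medialCornersAt x i k
    generalize medialCornersAt x i k = c at hck hce ⊢
    obtain ⟨v, f⟩ := c
    dsimp only at hck hce hp ⊢
    by_contra hne0
    unfold Parafermion.dartPhaseSum at hne0
    obtain ⟨j, hj, -⟩ := Finset.exists_ne_zero_of_sum_ne_zero hne0
    simp only [Finset.mem_filter, Finset.mem_range] at hj
    obtain ⟨-, hj1, hj2⟩ := hj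
    have hz : ((medialExploration (Λ δ) ω).zip (medialExploration (Λ δ) ω).tail)[j]? =
        some (cornerSource v f, cornerTarget v f) :=
      List.getElem?_zip_eq_some.2 ⟨hj1, by rw [List.getElem?_tail]; exact hj2⟩
    have hinf : [cornerSource v f, cornerTarget v f] <:+: medialExploration (Λ δ) ω :=
      infix_of_mem_zip_tail _ (List.mem_of_getElem? hz)
    rcases medialExploration_eq_nil_or (Λ δ) ω with h0 | hexp
    · rw [h0] at hj1
      simp at hj1
    · obtain ⟨v', f', hc', hinner, hs, ht⟩ := hexp.step _ _ hinf
      obtain ⟨-, rfl⟩ := IsCorner.eq_of_cornerSource_eq_of_cornerTarget_eq_holds hc' hck hs ht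
      have hdom := mem_meshDomain_of_isCorner_of_isInnerFace hck hinner
      rw [hΩeq, hδeq] at hdom
      refine hB v (hnear _ hp v ?_) hdom
      have hd := dist_medialPoint_cornerEdge_le hδ0.le hck i
      rw [hce, dist_comm] at hd
      linarith

end Summit.CriticalPhenomena.CardyFormulaZ2.Theorems.WeakHolomorphy.SplitBypass

end
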